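import Summits.QuantumAdvantage.AdviceFreeQNC0.WalkHardFLinTests
import HarnessLib

/-!
# Route OddPrimeWalk, row `LinTestsOdd` (stmt-QuantumAdvantage-23167, rung R11): Boolean linear TESTS mod `p`, every prime `p ≥ 5`

The item `LinTestsOdd` — `∀ p ≥ 5 prime, WalkHardFLinTests p`: a strategy reading the input only through
`K ≤ (log₂ n)^C` linear tests `[Σ_i λ_{j,i} u_i mod p ∈ A_j]` (dense coefficients, arbitrary accepting sets) and then
firing an arbitrary table of cuts per test outcome wins α's u-walk game `ringWinU` on at most `θ·2ⁿ` inputs — is the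
tree theorem `Summit.QuantumAdvantage.AdviceFreeQNC0.walkHardFLinTests (p) (hp3 : p ≠ 3)` (qn-prover-3 g9,
`AdviceFreeQNC0/WalkHardFLinTests.lean`, over R11' `walkHardFLinForms`: twisted transfer operators `cos(π/3p)`,
regularisation, junta main term) at `p ≥ 5`; the item's body and `WalkHardFLinTests p` agree verbatim.
WHAT THIS IS NOT: the dense residual of route OddPrimeWalk is open; separation NOT moved by this item alone.
-/

set_option linter.dupNamespace false

namespace Summit.QuantumAdvantage.QuantumAdvantage.Theorems

open Summit.QuantumAdvantage in
/-- **Row `LinTestsOdd` (rung R11) — PROVED**: `∀ p ≥ 5 prime, WalkHardFLinTests p`, spelled out verbatim as filed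
(one line over `AdviceFreeQNC0.walkHardFLinTests`). -/
theorem oddPrimeWalk_linTestsOdd :
    ∀ (p : ℕ) [Fact p.Prime], 5 ≤ p → ∃ θ : ℝ, θ < 1 ∧ ∀ C : ℕ, ∃ n₀ : ℕ, ∀ n ≥ n₀, ∀ c K : ℕ,
      K ≤ (Nat.log 2 n) ^ C → ∀ lam : Fin K → Fin n → ZMod p, ∀ A : Fin K → Finset (ZMod p),
      ∀ tab : Fin (n + 1) → (Fin K → Bool) → Bool,
        ((Finset.univ.filter fun u : Fin n → Bool =>
            AdviceFreeQNC0.ringWinU c (fun g v => tab g fun j => decide ((∑ i, if v i then lam j i else 0) ∈ A j)) u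
              = true).card : ℝ) ≤ θ * (2 : ℝ) ^ n :=
  fun p _ hp => Summit.QuantumAdvantage.AdviceFreeQNC0.walkHardFLinTests p (by omega)

end Summit.QuantumAdvantage.QuantumAdvantage.Theorems
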